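import Mathlib
import HarnessLib
import Summits.Ventures.LatticeQCDFlow.Exactness.GaugeFTHMCJensen
import Summits.Ventures.LatticeQCDFlow.Exactness.AcceptanceFromMeanEnergyViolation

/-!
# Acceptance versus mean energy violation for field-transformed gauge HMC: `1 − ⟨P_acc⟩ ≤ √(1 − e^{−⟨ΔH̃⟩}) ≤ √⟨ΔH̃⟩`, on the engine's rungs

HONEST FRAMING: exact (Metropolis-corrected) sampling algorithms for lattice gauge theory;
figures of merit are autocorrelation/cost numbers at stated couplings and volumes; no
continuum-physics claim.

Venture `LatticeQCDFlow` (cell pub-lqcd), topic `Exactness`; FANOUT row 14 (`eng-flowhmc`, engine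
`latflow.fthmc`, family B; the battery's `acceptance` and `dH` columns, "acceptance vs step size").
NEW WORK of the cell; no number.  Row 2's model-free bound
`AcceptanceFromMeanEnergyViolation.one_sub_acceptance_le_sqrt` (`1 − ∫ min(1, e^{−D}) ≤ √(1 − e^{−∫D})`
on any probability space with Creutz's identity `∫ e^{−D} = 1`) is instantiated for the EXACT
FT-HMC kernel in equilibrium, where Creutz's identity is `GaugeFTHMCCreutz.gauge_fthmc_leapfrog_creutz`
and `D = ΔH̃ = H̃ ∘ Ψ − H̃`, `H̃ = (S∘F − log J) + T`, `Ψ = flip ∘ leapfrog^n`: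

* **`gauge_fthmc_leapfrog_acceptance_ge`** — any group / left-invariant `μ` / certified `(F, J)` /
  measurable drift / ANY force / any `n`, `e^{−S}`, `e^{−T}` integrable, `ΔH̃` integrable in
  equilibrium: the equilibrium mean Metropolis acceptance `⟨min(1, e^{−ΔH̃})⟩` is at least
  `1 − √(1 − e^{−⟨ΔH̃⟩})`, and (`_sqrt_mean`) at least `1 − √⟨ΔH̃⟩`;
* **`gauge_fthmc_leapfrog_gaussian_acceptance_ge`** — the engine's rungs (probability Haar links,
  Gaussian momenta `κ → ℝ`);
* **`su2_fthmc_leapfrog_gaussian_acceptance_ge`** — the `SU(2)` rung with the quaternion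
  exponential drift, through ANY certified layer (LO member, learned residual layers, schedules).

Reading for the battery (no numerics implied): an FT-HMC row reporting equilibrium mean acceptance
`a` and mean energy violation `m` must satisfy `a ≥ 1 − √(1 − e^{−m})` up to statistics — a
model-free consistency check between two stored columns, valid for every member and step size.
NOT CLAIMED: the `erfc` law (Gaussian model of `ΔH̃`); how `m` scales with the step size; burn-in;
any number.
-/

noncomputable section

namespace Summit.Ventures.LatticeQCDFlow.Exactness

open Real Set MeasureTheory Measure WithLp
open Literature.Probability.MarkovChains.HMC
  (partitionFn boltzmann isProbabilityMeasure_boltzmann integrable_exp_neg_deltaH)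
open Literature.MathematicalPhysics.QuantumFieldTheory
open scoped ENNReal

/-! ## Any group -/

section General

variable {Q P : Type*} [MeasurableSpace Q] [MeasurableSpace P]

/-- **Equilibrium acceptance of FT-HMC is bounded below by the mean energy violation.**  For the
exact field-transformed gauge-link HMC kernel (certified `(F, J)`, group drift, any force, any `n`)
started from its `H̃`-Boltzmann law: `1 − ⟨min(1, e^{−ΔH̃})⟩ ≤ √(1 − e^{−⟨ΔH̃⟩})`. -/
theorem gauge_fthmc_leapfrog_acceptance_ge [Group Q] [MeasurableMul₂ Q] {μ : Measure Q}
    [μ.IsMulLeftInvariant] [SFinite μ] [NeZero μ] [AddCommGroup P] [MeasurableNeg P]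
    [MeasurableAdd₂ P] {ν : Measure P} [ν.IsNegInvariant] [ν.IsAddRightInvariant] [SFinite ν]
    [NeZero ν] {F : Q → Q} {J : Q → ℝ} (hJ : ∀ v, 0 < J v) (hJm : Measurable J)
    (hF : HasJacobian μ F fun v => ENNReal.ofReal (J v))
    {e : P → Q} (hem : Measurable e) {g : Q → P} (hg : Measurable g) (n : ℕ)
    {S : Q → ℝ} (hS : Measurable S) {T' : P → ℝ} (hT : Measurable T')
    (hSi : Integrable (fun v => Real.exp (-S v)) μ) (hTi : Integrable (fun p => Real.exp (-T' p)) ν)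
    (hδ : Integrable (fun z : Q × P =>
        ((S (F (((flip : Equiv.Perm (Q × P)) * leapfrog (mulDrift e) g ^ n) z).1) -
            Real.log (J (((flip : Equiv.Perm (Q × P)) * leapfrog (mulDrift e) g ^ n) z).1)) +
            T' (((flip : Equiv.Perm (Q × P)) * leapfrog (mulDrift e) g ^ n) z).2) -
          ((S (F z.1) - Real.log (J z.1)) + T' z.2))
      (boltzmann (μ.prod ν) fun z : Q × P => (S (F z.1) - Real.log (J z.1)) + T' z.2)) :
    1 - ∫ z, min 1 (Real.exp (-(((S (F (((flip : Equiv.Perm (Q × P)) * leapfrog (mulDrift e) g ^ n) z).1) -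
            Real.log (J (((flip : Equiv.Perm (Q × P)) * leapfrog (mulDrift e) g ^ n) z).1)) +
            T' (((flip : Equiv.Perm (Q × P)) * leapfrog (mulDrift e) g ^ n) z).2) -
          ((S (F z.1) - Real.log (J z.1)) + T' z.2))))
        ∂(boltzmann (μ.prod ν) fun z : Q × P => (S (F z.1) - Real.log (J z.1)) + T' z.2) ≤
      Real.sqrt (1 - Real.exp (-(∫ z, (((S (F (((flip : Equiv.Perm (Q × P)) * leapfrog (mulDrift e) g ^ n) z).1) -
            Real.log (J (((flip : Equiv.Perm (Q × P)) * leapfrog (mulDrift e) g ^ n) z).1)) +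
            T' (((flip : Equiv.Perm (Q × P)) * leapfrog (mulDrift e) g ^ n) z).2) -
          ((S (F z.1) - Real.log (J z.1)) + T' z.2))
        ∂(boltzmann (μ.prod ν) fun z : Q × P => (S (F z.1) - Real.log (J z.1)) + T' z.2)))) := by
  have hZ : 0 < partitionFn (μ.prod ν) (fun z : Q × P => S z.1 + T' z.2) :=
    partitionFn_prod_pos hSi hTi
  have hZ' : 0 < partitionFn (μ.prod ν)
      (fun z : Q × P => (S (F z.1) - Real.log (J z.1)) + T' z.2) := by
    rw [fthmc_partitionFn_eq hJ hJm hF hS hT]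
    exact hZ
  have hint := integrable_exp_neg_ftHamiltonian hJ hJm hF hS hT hSi hTi
  haveI := isProbabilityMeasure_boltzmann hint hZ'
  have hHm := measurable_ftHamiltonian hS hT hF.measurable hJm
  have hΨm : Measurable (⇑((flip : Equiv.Perm (Q × P)) * leapfrog (mulDrift e) g ^ n)) :=
    measurable_flip_leapfrog_pow (measurable_mulDrift hem) hg n
  exact one_sub_acceptance_le_sqrt ((hHm.comp hΨm).sub hHm) hδ
    (integrable_exp_neg_deltaH (H := fun z : Q × P => (S (F z.1) - Real.log (J z.1)) + T' z.2)
      (measurePreserving_gaugeLeapfrogProposal hem hg n) hHm hint hZ')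
    (gauge_fthmc_leapfrog_creutz hJ hJm hF hem hg n hS hT hZ)

/-- **… and the memorable weakening `1 − ⟨P_acc⟩ ≤ √⟨ΔH̃⟩`.** -/
theorem gauge_fthmc_leapfrog_acceptance_ge_sqrt_mean [Group Q] [MeasurableMul₂ Q] {μ : Measure Q}
    [μ.IsMulLeftInvariant] [SFinite μ] [NeZero μ] [AddCommGroup P] [MeasurableNeg P]
    [MeasurableAdd₂ P] {ν : Measure P} [ν.IsNegInvariant] [ν.IsAddRightInvariant] [SFinite ν]
    [NeZero ν] {F : Q → Q} {J : Q → ℝ} (hJ : ∀ v, 0 < J v) (hJm : Measurable J)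
    (hF : HasJacobian μ F fun v => ENNReal.ofReal (J v))
    {e : P → Q} (hem : Measurable e) {g : Q → P} (hg : Measurable g) (n : ℕ)
    {S : Q → ℝ} (hS : Measurable S) {T' : P → ℝ} (hT : Measurable T')
    (hSi : Integrable (fun v => Real.exp (-S v)) μ) (hTi : Integrable (fun p => Real.exp (-T' p)) ν)
    (hδ : Integrable (fun z : Q × P =>
        ((S (F (((flip : Equiv.Perm (Q × P)) * leapfrog (mulDrift e) g ^ n) z).1) -
            Real.log (J (((flip : Equiv.Perm (Q × P)) * leapfrog (mulDrift e) g ^ n) z).1)) +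
            T' (((flip : Equiv.Perm (Q × P)) * leapfrog (mulDrift e) g ^ n) z).2) -
          ((S (F z.1) - Real.log (J z.1)) + T' z.2))
      (boltzmann (μ.prod ν) fun z : Q × P => (S (F z.1) - Real.log (J z.1)) + T' z.2)) :
    1 - ∫ z, min 1 (Real.exp (-(((S (F (((flip : Equiv.Perm (Q × P)) * leapfrog (mulDrift e) g ^ n) z).1) -
            Real.log (J (((flip : Equiv.Perm (Q × P)) * leapfrog (mulDrift e) g ^ n) z).1)) +
            T' (((flip : Equiv.Perm (Q × P)) * leapfrog (mulDrift e) g ^ n) z).2) -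
          ((S (F z.1) - Real.log (J z.1)) + T' z.2))))
        ∂(boltzmann (μ.prod ν) fun z : Q × P => (S (F z.1) - Real.log (J z.1)) + T' z.2) ≤
      Real.sqrt (∫ z, (((S (F (((flip : Equiv.Perm (Q × P)) * leapfrog (mulDrift e) g ^ n) z).1) -
            Real.log (J (((flip : Equiv.Perm (Q × P)) * leapfrog (mulDrift e) g ^ n) z).1)) +
            T' (((flip : Equiv.Perm (Q × P)) * leapfrog (mulDrift e) g ^ n) z).2) -
          ((S (F z.1) - Real.log (J z.1)) + T' z.2))
        ∂(boltzmann (μ.prod ν) fun z : Q × P => (S (F z.1) - Real.log (J z.1)) + T' z.2)) := by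
  refine (gauge_fthmc_leapfrog_acceptance_ge hJ hJm hF hem hg n hS hT hSi hTi hδ).trans
    (Real.sqrt_le_sqrt ?_)
  have h := Real.add_one_le_exp (-(∫ z, (((S (F (((flip : Equiv.Perm (Q × P)) * leapfrog (mulDrift e) g ^ n) z).1) -
            Real.log (J (((flip : Equiv.Perm (Q × P)) * leapfrog (mulDrift e) g ^ n) z).1)) +
            T' (((flip : Equiv.Perm (Q × P)) * leapfrog (mulDrift e) g ^ n) z).2) -
          ((S (F z.1) - Real.log (J z.1)) + T' z.2))
        ∂(boltzmann (μ.prod ν) fun z : Q × P => (S (F z.1) - Real.log (J z.1)) + T' z.2)))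
  linarith

end General

/-! ## The engine's rungs -/

section Gaussian

variable {Q : Type*} [MeasurableSpace Q] {κ : Type*} [Fintype κ]

/-- **Acceptance bound on the engine's rungs** (probability Haar links, Gaussian momenta
`κ → ℝ`, `T = Σ p²/2`, any drift / force / `n`, `e^{−S}` integrable, any certified `(F, J)`). -/
theorem gauge_fthmc_leapfrog_gaussian_acceptance_ge [Group Q] [MeasurableMul₂ Q] {μ : Measure Q}
    [μ.IsMulLeftInvariant] [IsProbabilityMeasure μ]
    {F : Q → Q} {J : Q → ℝ} (hJ : ∀ v, 0 < J v) (hJm : Measurable J)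
    (hF : HasJacobian μ F fun v => ENNReal.ofReal (J v))
    {e : (κ → ℝ) → Q} (hem : Measurable e) {g : Q → (κ → ℝ)} (hg : Measurable g) (n : ℕ)
    {S : Q → ℝ} (hS : Measurable S) (hSi : Integrable (fun v => Real.exp (-S v)) μ)
    (hδ : Integrable (fun z : Q × (κ → ℝ) =>
        ((S (F (((flip : Equiv.Perm (Q × (κ → ℝ))) * leapfrog (mulDrift e) g ^ n) z).1) -
            Real.log (J (((flip : Equiv.Perm (Q × (κ → ℝ))) * leapfrog (mulDrift e) g ^ n) z).1)) +
            ∑ i, (((flip : Equiv.Perm (Q × (κ → ℝ))) * leapfrog (mulDrift e) g ^ n) z).2 i ^ 2 / 2) -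
          ((S (F z.1) - Real.log (J z.1)) + ∑ i, z.2 i ^ 2 / 2))
      (boltzmann (μ.prod (volume : Measure (κ → ℝ)))
        fun z : Q × (κ → ℝ) => (S (F z.1) - Real.log (J z.1)) + ∑ i, z.2 i ^ 2 / 2)) :
    1 - ∫ z, min 1 (Real.exp (-(((S (F (((flip : Equiv.Perm (Q × (κ → ℝ))) * leapfrog (mulDrift e) g ^ n) z).1) -
            Real.log (J (((flip : Equiv.Perm (Q × (κ → ℝ))) * leapfrog (mulDrift e) g ^ n) z).1)) +
            ∑ i, (((flip : Equiv.Perm (Q × (κ → ℝ))) * leapfrog (mulDrift e) g ^ n) z).2 i ^ 2 / 2) -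
          ((S (F z.1) - Real.log (J z.1)) + ∑ i, z.2 i ^ 2 / 2))))
        ∂(boltzmann (μ.prod (volume : Measure (κ → ℝ)))
          fun z : Q × (κ → ℝ) => (S (F z.1) - Real.log (J z.1)) + ∑ i, z.2 i ^ 2 / 2) ≤
      Real.sqrt (1 - Real.exp (-(∫ z, (((S (F (((flip : Equiv.Perm (Q × (κ → ℝ))) * leapfrog (mulDrift e) g ^ n) z).1) -
            Real.log (J (((flip : Equiv.Perm (Q × (κ → ℝ))) * leapfrog (mulDrift e) g ^ n) z).1)) +
            ∑ i, (((flip : Equiv.Perm (Q × (κ → ℝ))) * leapfrog (mulDrift e) g ^ n) z).2 i ^ 2 / 2) -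
          ((S (F z.1) - Real.log (J z.1)) + ∑ i, z.2 i ^ 2 / 2))
        ∂(boltzmann (μ.prod (volume : Measure (κ → ℝ)))
          fun z : Q × (κ → ℝ) => (S (F z.1) - Real.log (J z.1)) + ∑ i, z.2 i ^ 2 / 2)))) := by
  haveI := isNegInvariant_volume_pi (Λ := κ)
  haveI := neZero_volume_pi (κ := κ)
  exact gauge_fthmc_leapfrog_acceptance_ge (ν := (volume : Measure (κ → ℝ)))
    (T' := fun p : κ → ℝ => ∑ i, p i ^ 2 / 2) hJ hJm hF hem hg n hS measurable_piGaussianKinetic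
    hSi integrable_exp_neg_piGaussianKinetic hδ

end Gaussian

/-! ## The `SU(2)` rung -/

section SU2

variable {d L : ℕ} [NeZero L]

/-- **Acceptance bound for FT-HMC on the `SU(2)` rung as the engine runs it** (quaternion
exponential drift, ANY force, any `n`, `e^{−S}` integrable, ANY certified layer — LO member,
learned residual layers, schedules): in equilibrium `1 − ⟨P_acc⟩ ≤ √(1 − e^{−⟨ΔH̃⟩})`. -/
theorem su2_fthmc_leapfrog_gaussian_acceptance_ge
    {F : GaugeConfig d L (Matrix.specialUnitaryGroup (Fin 2) ℂ) → GaugeConfig d L (Matrix.specialUnitaryGroup (Fin 2) ℂ)} {J : GaugeConfig d L (Matrix.specialUnitaryGroup (Fin 2) ℂ) → ℝ} (hJ : ∀ V, 0 < J V)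
    (hJm : Measurable J)
    (hF : HasJacobian (Measure.pi fun _ : Edge d L => haarProbability (Matrix.specialUnitaryGroup (Fin 2) ℂ)) F
      fun V => ENNReal.ofReal (J V))
    {S : GaugeConfig d L (Matrix.specialUnitaryGroup (Fin 2) ℂ) → ℝ} (hS : Measurable S)
    (hSi : Integrable (fun V => Real.exp (-S V))
      (Measure.pi fun _ : Edge d L => haarProbability (Matrix.specialUnitaryGroup (Fin 2) ℂ)))
    (c : ℝ) {g : GaugeConfig d L (Matrix.specialUnitaryGroup (Fin 2) ℂ) → ((Edge d L × Fin 3) → ℝ)} (hg : Measurable g) (n : ℕ)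
    (hδ : Integrable (fun z : GaugeConfig d L (Matrix.specialUnitaryGroup (Fin 2) ℂ) × ((Edge d L × Fin 3) → ℝ) =>
        ((S (F ((((flip : Equiv.Perm (GaugeConfig d L (Matrix.specialUnitaryGroup (Fin 2) ℂ) × ((Edge d L × Fin 3) → ℝ))) *
              leapfrog (mulDrift (fun p : (Edge d L × Fin 3) → ℝ => fun ℓ : Edge d L => gaussUnit (toLp 2
          ![Real.cos (c * Real.sqrt (p (ℓ, 0) ^ 2 + p (ℓ, 1) ^ 2 + p (ℓ, 2) ^ 2)),
            c * Real.sinc (c * Real.sqrt (p (ℓ, 0) ^ 2 + p (ℓ, 1) ^ 2 + p (ℓ, 2) ^ 2)) * p (ℓ, 0),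
            c * Real.sinc (c * Real.sqrt (p (ℓ, 0) ^ 2 + p (ℓ, 1) ^ 2 + p (ℓ, 2) ^ 2)) * p (ℓ, 1),
            c * Real.sinc (c * Real.sqrt (p (ℓ, 0) ^ 2 + p (ℓ, 1) ^ 2 + p (ℓ, 2) ^ 2)) * p (ℓ, 2)]))) g ^ n)) z).1) -
            Real.log (J ((((flip : Equiv.Perm (GaugeConfig d L (Matrix.specialUnitaryGroup (Fin 2) ℂ) × ((Edge d L × Fin 3) → ℝ))) *
              leapfrog (mulDrift (fun p : (Edge d L × Fin 3) → ℝ => fun ℓ : Edge d L => gaussUnit (toLp 2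
          ![Real.cos (c * Real.sqrt (p (ℓ, 0) ^ 2 + p (ℓ, 1) ^ 2 + p (ℓ, 2) ^ 2)),
            c * Real.sinc (c * Real.sqrt (p (ℓ, 0) ^ 2 + p (ℓ, 1) ^ 2 + p (ℓ, 2) ^ 2)) * p (ℓ, 0),
            c * Real.sinc (c * Real.sqrt (p (ℓ, 0) ^ 2 + p (ℓ, 1) ^ 2 + p (ℓ, 2) ^ 2)) * p (ℓ, 1),
            c * Real.sinc (c * Real.sqrt (p (ℓ, 0) ^ 2 + p (ℓ, 1) ^ 2 + p (ℓ, 2) ^ 2)) * p (ℓ, 2)]))) g ^ n)) z).1)) +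
            ∑ i, ((((flip : Equiv.Perm (GaugeConfig d L (Matrix.specialUnitaryGroup (Fin 2) ℂ) × ((Edge d L × Fin 3) → ℝ))) *
              leapfrog (mulDrift (fun p : (Edge d L × Fin 3) → ℝ => fun ℓ : Edge d L => gaussUnit (toLp 2
          ![Real.cos (c * Real.sqrt (p (ℓ, 0) ^ 2 + p (ℓ, 1) ^ 2 + p (ℓ, 2) ^ 2)),
            c * Real.sinc (c * Real.sqrt (p (ℓ, 0) ^ 2 + p (ℓ, 1) ^ 2 + p (ℓ, 2) ^ 2)) * p (ℓ, 0),
            c * Real.sinc (c * Real.sqrt (p (ℓ, 0) ^ 2 + p (ℓ, 1) ^ 2 + p (ℓ, 2) ^ 2)) * p (ℓ, 1),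
            c * Real.sinc (c * Real.sqrt (p (ℓ, 0) ^ 2 + p (ℓ, 1) ^ 2 + p (ℓ, 2) ^ 2)) * p (ℓ, 2)]))) g ^ n)) z).2 i ^ 2 / 2) -
          ((S (F z.1) - Real.log (J z.1)) + ∑ i, z.2 i ^ 2 / 2))
      (boltzmann ((Measure.pi fun _ : Edge d L => haarProbability (Matrix.specialUnitaryGroup (Fin 2) ℂ)).prod
            (volume : Measure ((Edge d L × Fin 3) → ℝ)))
          fun z : GaugeConfig d L (Matrix.specialUnitaryGroup (Fin 2) ℂ) × ((Edge d L × Fin 3) → ℝ) => (S (F z.1) - Real.log (J z.1)) + ∑ i, z.2 i ^ 2 / 2)) :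
    1 - ∫ z, min 1 (Real.exp (-(((S (F ((((flip : Equiv.Perm (GaugeConfig d L (Matrix.specialUnitaryGroup (Fin 2) ℂ) × ((Edge d L × Fin 3) → ℝ))) *
              leapfrog (mulDrift (fun p : (Edge d L × Fin 3) → ℝ => fun ℓ : Edge d L => gaussUnit (toLp 2
          ![Real.cos (c * Real.sqrt (p (ℓ, 0) ^ 2 + p (ℓ, 1) ^ 2 + p (ℓ, 2) ^ 2)),
            c * Real.sinc (c * Real.sqrt (p (ℓ, 0) ^ 2 + p (ℓ, 1) ^ 2 + p (ℓ, 2) ^ 2)) * p (ℓ, 0),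
            c * Real.sinc (c * Real.sqrt (p (ℓ, 0) ^ 2 + p (ℓ, 1) ^ 2 + p (ℓ, 2) ^ 2)) * p (ℓ, 1),
            c * Real.sinc (c * Real.sqrt (p (ℓ, 0) ^ 2 + p (ℓ, 1) ^ 2 + p (ℓ, 2) ^ 2)) * p (ℓ, 2)]))) g ^ n)) z).1) -
            Real.log (J ((((flip : Equiv.Perm (GaugeConfig d L (Matrix.specialUnitaryGroup (Fin 2) ℂ) × ((Edge d L × Fin 3) → ℝ))) *
              leapfrog (mulDrift (fun p : (Edge d L × Fin 3) → ℝ => fun ℓ : Edge d L => gaussUnit (toLp 2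
          ![Real.cos (c * Real.sqrt (p (ℓ, 0) ^ 2 + p (ℓ, 1) ^ 2 + p (ℓ, 2) ^ 2)),
            c * Real.sinc (c * Real.sqrt (p (ℓ, 0) ^ 2 + p (ℓ, 1) ^ 2 + p (ℓ, 2) ^ 2)) * p (ℓ, 0),
            c * Real.sinc (c * Real.sqrt (p (ℓ, 0) ^ 2 + p (ℓ, 1) ^ 2 + p (ℓ, 2) ^ 2)) * p (ℓ, 1),
            c * Real.sinc (c * Real.sqrt (p (ℓ, 0) ^ 2 + p (ℓ, 1) ^ 2 + p (ℓ, 2) ^ 2)) * p (ℓ, 2)]))) g ^ n)) z).1)) +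
            ∑ i, ((((flip : Equiv.Perm (GaugeConfig d L (Matrix.specialUnitaryGroup (Fin 2) ℂ) × ((Edge d L × Fin 3) → ℝ))) *
              leapfrog (mulDrift (fun p : (Edge d L × Fin 3) → ℝ => fun ℓ : Edge d L => gaussUnit (toLp 2
          ![Real.cos (c * Real.sqrt (p (ℓ, 0) ^ 2 + p (ℓ, 1) ^ 2 + p (ℓ, 2) ^ 2)),
            c * Real.sinc (c * Real.sqrt (p (ℓ, 0) ^ 2 + p (ℓ, 1) ^ 2 + p (ℓ, 2) ^ 2)) * p (ℓ, 0),
            c * Real.sinc (c * Real.sqrt (p (ℓ, 0) ^ 2 + p (ℓ, 1) ^ 2 + p (ℓ, 2) ^ 2)) * p (ℓ, 1),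
            c * Real.sinc (c * Real.sqrt (p (ℓ, 0) ^ 2 + p (ℓ, 1) ^ 2 + p (ℓ, 2) ^ 2)) * p (ℓ, 2)]))) g ^ n)) z).2 i ^ 2 / 2) -
          ((S (F z.1) - Real.log (J z.1)) + ∑ i, z.2 i ^ 2 / 2))))
        ∂(boltzmann ((Measure.pi fun _ : Edge d L => haarProbability (Matrix.specialUnitaryGroup (Fin 2) ℂ)).prod
            (volume : Measure ((Edge d L × Fin 3) → ℝ)))
          fun z : GaugeConfig d L (Matrix.specialUnitaryGroup (Fin 2) ℂ) × ((Edge d L × Fin 3) → ℝ) => (S (F z.1) - Real.log (J z.1)) + ∑ i, z.2 i ^ 2 / 2) ≤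
      Real.sqrt (1 - Real.exp (-(∫ z, (((S (F ((((flip : Equiv.Perm (GaugeConfig d L (Matrix.specialUnitaryGroup (Fin 2) ℂ) × ((Edge d L × Fin 3) → ℝ))) *
              leapfrog (mulDrift (fun p : (Edge d L × Fin 3) → ℝ => fun ℓ : Edge d L => gaussUnit (toLp 2
          ![Real.cos (c * Real.sqrt (p (ℓ, 0) ^ 2 + p (ℓ, 1) ^ 2 + p (ℓ, 2) ^ 2)),
            c * Real.sinc (c * Real.sqrt (p (ℓ, 0) ^ 2 + p (ℓ, 1) ^ 2 + p (ℓ, 2) ^ 2)) * p (ℓ, 0),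
            c * Real.sinc (c * Real.sqrt (p (ℓ, 0) ^ 2 + p (ℓ, 1) ^ 2 + p (ℓ, 2) ^ 2)) * p (ℓ, 1),
            c * Real.sinc (c * Real.sqrt (p (ℓ, 0) ^ 2 + p (ℓ, 1) ^ 2 + p (ℓ, 2) ^ 2)) * p (ℓ, 2)]))) g ^ n)) z).1) -
            Real.log (J ((((flip : Equiv.Perm (GaugeConfig d L (Matrix.specialUnitaryGroup (Fin 2) ℂ) × ((Edge d L × Fin 3) → ℝ))) *
              leapfrog (mulDrift (fun p : (Edge d L × Fin 3) → ℝ => fun ℓ : Edge d L => gaussUnit (toLp 2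
          ![Real.cos (c * Real.sqrt (p (ℓ, 0) ^ 2 + p (ℓ, 1) ^ 2 + p (ℓ, 2) ^ 2)),
            c * Real.sinc (c * Real.sqrt (p (ℓ, 0) ^ 2 + p (ℓ, 1) ^ 2 + p (ℓ, 2) ^ 2)) * p (ℓ, 0),
            c * Real.sinc (c * Real.sqrt (p (ℓ, 0) ^ 2 + p (ℓ, 1) ^ 2 + p (ℓ, 2) ^ 2)) * p (ℓ, 1),
            c * Real.sinc (c * Real.sqrt (p (ℓ, 0) ^ 2 + p (ℓ, 1) ^ 2 + p (ℓ, 2) ^ 2)) * p (ℓ, 2)]))) g ^ n)) z).1)) +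
            ∑ i, ((((flip : Equiv.Perm (GaugeConfig d L (Matrix.specialUnitaryGroup (Fin 2) ℂ) × ((Edge d L × Fin 3) → ℝ))) *
              leapfrog (mulDrift (fun p : (Edge d L × Fin 3) → ℝ => fun ℓ : Edge d L => gaussUnit (toLp 2
          ![Real.cos (c * Real.sqrt (p (ℓ, 0) ^ 2 + p (ℓ, 1) ^ 2 + p (ℓ, 2) ^ 2)),
            c * Real.sinc (c * Real.sqrt (p (ℓ, 0) ^ 2 + p (ℓ, 1) ^ 2 + p (ℓ, 2) ^ 2)) * p (ℓ, 0),
            c * Real.sinc (c * Real.sqrt (p (ℓ, 0) ^ 2 + p (ℓ, 1) ^ 2 + p (ℓ, 2) ^ 2)) * p (ℓ, 1),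
            c * Real.sinc (c * Real.sqrt (p (ℓ, 0) ^ 2 + p (ℓ, 1) ^ 2 + p (ℓ, 2) ^ 2)) * p (ℓ, 2)]))) g ^ n)) z).2 i ^ 2 / 2) -
          ((S (F z.1) - Real.log (J z.1)) + ∑ i, z.2 i ^ 2 / 2))
        ∂(boltzmann ((Measure.pi fun _ : Edge d L => haarProbability (Matrix.specialUnitaryGroup (Fin 2) ℂ)).prod
            (volume : Measure ((Edge d L × Fin 3) → ℝ)))
          fun z : GaugeConfig d L (Matrix.specialUnitaryGroup (Fin 2) ℂ) × ((Edge d L × Fin 3) → ℝ) => (S (F z.1) - Real.log (J z.1)) + ∑ i, z.2 i ^ 2 / 2)))) :=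
  gauge_fthmc_leapfrog_gaussian_acceptance_ge hJ hJm hF (measurable_su2Drift c) hg n hS hSi hδ

end SU2

end Summit.Ventures.LatticeQCDFlow.Exactness
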